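import Mathlib
import Literature.Analysis.FluidPDE.EnstrophySplittingDissipation
import Summits.NavierStokesRegularity.NavierStokesRegularity.Theorems.LevelSetModerationLevelSetEnergyInequalityViscousStep

/-!
# Route LevelSetModeration — `LevelSetEnergyInequality`: the viscous term (helper file 3b)

Support lemma for item stmt-NavierStokesRegularity-18151 (Vasseur 2007, Lemma 11, the step
"`|∇|u|| ≤ |∇u|`" of the level-set energy inequality, globalised). For a `C²` field `u` on `ℝ³`
with `u, Du, D²u ∈ L²` and a level `c > 0`, with the truncation weight
`k₀(u) = (|u| - c)₊ / max(|u|, c)` (`= (1 - c/|u|)₊`):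

  `∫ k₀(u) ⟪Δu, u⟫ ≤ -∫ 1_{|u| > c} Σᵢ ⟪u, ∂ᵢu⟫² / max(|u|,c)²`   (`viscous_slice`),

obtained from the regularised inequality `viscous_step` (file 3a) for `h = hₙ` of
`exists_regularisation` by dominated convergence (`hₙ(k₀) + hₙ'(k₀)(1 - k₀) → 1_{|u| > c}`).

## References
* A. F. Vasseur, NoDEA 14 (2007), Lemma 11 and its proof, (12). [Vasseur2007]
-/

noncomputable section

-- single-conjunct summit: `Summit.<Summit>.<Problem>` repeats the name by the D-0017 layout
set_option linter.dupNamespace false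

namespace Summit.NavierStokesRegularity.NavierStokesRegularity.Theorems.LevelSetEnergyInequality

open Real Set Filter Topology MeasureTheory InnerProductSpace
open scoped RealInnerProductSpace ENNReal Laplacian
open Literature.Analysis.FluidPDE

/-- The level gradient density `G = Σᵢ ⟪u, ∂ᵢu⟫² / max(|u|, c)²` of a `C¹` field with `Du ∈ L²`
is continuous, nonnegative and integrable (`G ≤ Σᵢ ‖∂ᵢu‖²`). -/
theorem integrable_levelGradSq {c : ℝ} (hc : 0 < c)
    {u : EuclideanSpace ℝ (Fin 3) → EuclideanSpace ℝ (Fin 3)} (hu : ContDiff ℝ 1 u)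
    (h1 : ∫⁻ x, ‖iteratedFDeriv ℝ 1 u x‖ₑ ^ 2 < ⊤) :
    (Continuous fun x => (∑ i, ⟪u x, fderiv ℝ u x (EuclideanSpace.basisFun (Fin 3) ℝ i)⟫ ^ 2) /
        max ‖u x‖ c ^ 2) ∧
    (∀ x, 0 ≤ (∑ i, ⟪u x, fderiv ℝ u x (EuclideanSpace.basisFun (Fin 3) ℝ i)⟫ ^ 2) /
        max ‖u x‖ c ^ 2) ∧
    Integrable (fun x => (∑ i, ⟪u x, fderiv ℝ u x (EuclideanSpace.basisFun (Fin 3) ℝ i)⟫ ^ 2) /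
        max ‖u x‖ c ^ 2) volume := by
  set e := EuclideanSpace.basisFun (Fin 3) ℝ with he
  have cu : Continuous u := hu.continuous
  have cDu : Continuous (fderiv ℝ u) := hu.continuous_fderiv one_ne_zero
  have cmax : Continuous fun x => max ‖u x‖ c := by fun_prop
  have hmaxpos : ∀ x, 0 < max ‖u x‖ c := fun x => lt_of_lt_of_le hc (le_max_right _ _)
  have cG : Continuous fun x => (∑ i, ⟪u x, fderiv ℝ u x (e i)⟫ ^ 2) / max ‖u x‖ c ^ 2 :=
    Continuous.div (by fun_prop) (cmax.pow 2) fun x => (pow_pos (hmaxpos x) 2).ne'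
  have hG0 : ∀ x, 0 ≤ (∑ i, ⟪u x, fderiv ℝ u x (e i)⟫ ^ 2) / max ‖u x‖ c ^ 2 := fun x =>
    div_nonneg (Finset.sum_nonneg fun i _ => sq_nonneg _) (sq_nonneg _)
  refine ⟨cG, hG0, ?_⟩
  have cdi : ∀ i, Continuous fun x => fderiv ℝ u x (e i) := fun i => cDu.clm_apply continuous_const
  have l2di : ∀ i, ∫⁻ x, ‖fderiv ℝ u x (e i)‖ₑ ^ 2 < ⊤ := fun i =>
    lintegral_enorm_sq_lt_top_of_norm_le (fun x => norm_fderiv_apply_basisFun_le u x i) h1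
  have iF : Integrable (fun x => ∑ i, ‖fderiv ℝ u x (e i)‖ ^ 2) volume :=
    integrable_finsetSum _ fun i _ => integrable_sq_norm_of_lintegral_lt_top (cdi i) (l2di i)
  exact iF.mono' cG.aestronglyMeasurable (Eventually.of_forall fun x => by
    rw [Real.norm_of_nonneg (hG0 x)]; exact levelGradSq_le_sum_sq hc u x)

/-- **The viscous term of the level-set energy inequality** (Vasseur 2007, Lemma 11, global form on
`ℝ³`): for `u ∈ C²` with `u, Du, D²u ∈ L²` and `c > 0`,
`∫ k₀(u) ⟪Δu, u⟫ ≤ -∫ 1_{|u|>c} Σᵢ⟪u, ∂ᵢu⟫² / max(|u|,c)²`, where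
`k₀(u) = (|u|-c)₊ / max(|u|,c)` (`viscous_step` for `h = hₙ` of `exists_regularisation`, then
dominated convergence). -/
theorem viscous_slice {c : ℝ} (hc : 0 < c)
    {u : EuclideanSpace ℝ (Fin 3) → EuclideanSpace ℝ (Fin 3)} (hu : ContDiff ℝ 2 u)
    (h0 : ∫⁻ x, ‖u x‖ₑ ^ 2 < ⊤) (h1 : ∫⁻ x, ‖iteratedFDeriv ℝ 1 u x‖ₑ ^ 2 < ⊤)
    (h2 : ∫⁻ x, ‖iteratedFDeriv ℝ 2 u x‖ₑ ^ 2 < ⊤) :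
    ∫ x, max (‖u x‖ - c) 0 / max ‖u x‖ c * ⟪(Δ u) x, u x⟫ ≤
      -∫ x, Set.indicator {x | c < ‖u x‖}
        (fun x => (∑ i, ⟪u x, fderiv ℝ u x (EuclideanSpace.basisFun (Fin 3) ℝ i)⟫ ^ 2) /
          max ‖u x‖ c ^ 2) x := by
  set e := EuclideanSpace.basisFun (Fin 3) ℝ with he
  obtain ⟨k, hk⟩ : ∃ k : EuclideanSpace ℝ (Fin 3) → ℝ, k = fun v => max (‖v‖ - c) 0 / max ‖v‖ c :=
    ⟨_, rfl⟩
  obtain ⟨G, hG⟩ : ∃ G : EuclideanSpace ℝ (Fin 3) → ℝ,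
      G = fun x => (∑ i, ⟪u x, fderiv ℝ u x (e i)⟫ ^ 2) / max ‖u x‖ c ^ 2 := ⟨_, rfl⟩
  have hkx : ∀ v, k v = max (‖v‖ - c) 0 / max ‖v‖ c := fun v => by rw [hk]
  have hGx : ∀ x, G x = (∑ i, ⟪u x, fderiv ℝ u x (e i)⟫ ^ 2) / max ‖u x‖ c ^ 2 := fun x => by
    rw [hG]
  -- restate the goal with `k`, `G`
  suffices hmain : ∫ x, k (u x) * ⟪(Δ u) x, u x⟫ ≤ -∫ x, Set.indicator {x | c < ‖u x‖} G x by
    simpa only [hk, hG] using hmain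
  obtain ⟨h, h', M, hder, hcont, hcont', hvan, hbd, hM, hlim, hlim'⟩ := exists_regularisation
  have hM0 : 0 ≤ M := (abs_nonneg _).trans (hM 0 0)
  have cu : Continuous u := hu.continuous
  have cΔ : Continuous (Δ u) := continuous_laplacian hu
  have cku : Continuous fun x => k (u x) := by rw [hk]; exact (continuous_weight hc).comp cu
  have hk01 : ∀ x, 0 ≤ k (u x) ∧ k (u x) ≤ 1 := fun x => by
    rw [hkx]; exact ⟨weight_nonneg hc _, weight_le_one hc _⟩
  obtain ⟨cG, hG0, iG⟩ : Continuous G ∧ (∀ x, 0 ≤ G x) ∧ Integrable G volume := by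
    rw [hG]; exact integrable_levelGradSq hc (hu.of_le one_le_two) h1
  have l2Δ : ∫⁻ x, ‖(Δ u) x‖ₑ ^ 2 < ⊤ := by
    have h3 : ∫⁻ x, ‖(3 : ℝ) • iteratedFDeriv ℝ 2 u x‖ₑ ^ 2 < ⊤ :=
      lintegral_enorm_sq_const_smul_lt_top 3 h2
    refine lintegral_enorm_sq_lt_top_of_norm_le (fun x => ?_) h3
    rw [norm_smul, Real.norm_of_nonneg (by norm_num : (0 : ℝ) ≤ 3)]
    exact norm_laplacian_le_three_mul_norm_iteratedFDeriv_two hu x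
  have iΔu : Integrable (fun x => ⟪(Δ u) x, u x⟫) volume :=
    integrable_of_norm_le_mul_of_lintegral_sq (cΔ.inner cu).aestronglyMeasurable cΔ cu l2Δ h0
      fun x => norm_inner_le_norm _ _
  -- the regularised inequalities
  have hstep : ∀ n : ℕ, ∫ x, h n (k (u x)) * ⟪(Δ u) x, u x⟫ ≤
      -∫ x, (h n (k (u x)) + h' n (k (u x)) * (1 - k (u x))) * G x := by
    intro n
    obtain ⟨δ, hδ, hδ0⟩ := hvan n
    have := viscous_step hc hu h0 h1 h2 (hder n) (hcont n) (hcont' n) hδ hδ0 (hbd n) (hM n)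
    simpa only [hk, hG] using this
  -- measurability of the two sequences of integrands
  have mL : ∀ n, Continuous fun x => h n (k (u x)) * ⟪(Δ u) x, u x⟫ := fun n =>
    ((hcont n).comp cku).mul (cΔ.inner cu)
  have mR : ∀ n, Continuous fun x => (h n (k (u x)) + h' n (k (u x)) * (1 - k (u x))) * G x :=
    fun n => (((hcont n).comp cku).add (((hcont' n).comp cku).mul (continuous_const.sub cku))).mul cG
  -- ### the limit `n → ∞` by dominated convergence
  have hL : Tendsto (fun n => ∫ x, h n (k (u x)) * ⟪(Δ u) x, u x⟫) atTop
      (𝓝 (∫ x, k (u x) * ⟪(Δ u) x, u x⟫)) := by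
    refine tendsto_integral_of_dominated_convergence _ (fun n => (mL n).aestronglyMeasurable)
      iΔu.norm (fun n => ?_) ?_
    · filter_upwards with x
      rw [norm_mul]
      refine mul_le_of_le_one_left (norm_nonneg _) ?_
      have := hbd n (k (u x)) (hk01 x).1
      rw [Real.norm_of_nonneg this.1]
      exact this.2.trans (hk01 x).2
    · filter_upwards with x
      refine Tendsto.mul_const _ ?_
      rcases (hk01 x).1.lt_or_eq with hpos | hzero
      · exact hlim _ hpos
      · rw [← hzero]
        have h00 : ∀ n, h n 0 = 0 := fun n => le_antisymm (hbd n 0 le_rfl).2 (hbd n 0 le_rfl).1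
        simp only [h00]
        exact tendsto_const_nhds
  have hR : Tendsto (fun n => ∫ x, (h n (k (u x)) + h' n (k (u x)) * (1 - k (u x))) * G x) atTop
      (𝓝 (∫ x, Set.indicator {x | c < ‖u x‖} G x)) := by
    refine tendsto_integral_of_dominated_convergence _ (fun n => (mR n).aestronglyMeasurable)
      (iG.const_mul (1 + M)) (fun n => ?_) ?_
    · filter_upwards with x
      rw [norm_mul, Real.norm_of_nonneg (hG0 x)]
      refine mul_le_mul_of_nonneg_right ?_ (hG0 x)
      have hkn01 : 0 ≤ h n (k (u x)) ∧ h n (k (u x)) ≤ 1 :=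
        ⟨(hbd n _ (hk01 x).1).1, (hbd n _ (hk01 x).1).2.trans (hk01 x).2⟩
      calc ‖h n (k (u x)) + h' n (k (u x)) * (1 - k (u x))‖
          ≤ |h n (k (u x))| + |h' n (k (u x)) * (1 - k (u x))| := by
            rw [Real.norm_eq_abs]; exact abs_add_le _ _
        _ = |h n (k (u x))| + |h' n (k (u x))| * |1 - k (u x)| := by rw [abs_mul]
        _ ≤ 1 + M * 1 := by
            gcongr
            · rw [abs_of_nonneg hkn01.1]; exact hkn01.2
            · exact hM n _
            · rw [abs_of_nonneg (by linarith [(hk01 x).2])]; linarith [(hk01 x).1]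
        _ = 1 + M := by ring
    · filter_upwards with x
      by_cases hx : c < ‖u x‖
      · rw [Set.indicator_of_mem (show x ∈ {x | c < ‖u x‖} from hx)]
        have hpos : 0 < k (u x) := by rw [hkx]; exact (weight_pos_iff hc _).2 hx
        have hl : Tendsto (fun n => h n (k (u x)) + h' n (k (u x)) * (1 - k (u x))) atTop
            (𝓝 (k (u x) + 1 * (1 - k (u x)))) :=
          (hlim _ hpos).add ((hlim' _ hpos).mul_const _)
        have h1' : k (u x) + 1 * (1 - k (u x)) = 1 := by ring
        rw [h1'] at hl
        simpa using hl.mul_const (G x)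
      · rw [Set.indicator_of_notMem (show x ∉ {x | c < ‖u x‖} from hx)]
        have hk0 : k (u x) = 0 := by rw [hkx]; exact weight_eq_zero_of_norm_le _ (not_lt.1 hx)
        have hzero : ∀ n, (h n (k (u x)) + h' n (k (u x)) * (1 - k (u x))) * G x = 0 := by
          intro n
          obtain ⟨δ, hδ, hδ0⟩ := hvan n
          rw [hk0, (hδ0 0 hδ.le).1, (hδ0 0 hδ.le).2]
          ring
        simp only [hzero]
        exact tendsto_const_nhds
  exact le_of_tendsto_of_tendsto' hL hR.neg hstep

end Summit.NavierStokesRegularity.NavierStokesRegularity.Theorems.LevelSetEnergyInequality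

end
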